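import Literature.NumberTheory.EllipticCurves.Selmer
import Literature.NumberTheory.EllipticCurves.PointDivisibility
import Literature.NumberTheory.EllipticCurves.SelmerCorankProofs
import Literature.NumberTheory.EllipticCurves.H1UnramifiedFinite
import Literature.NumberTheory.GaloisRepresentations.ContinuousH1
import HarnessLib

/-!
# The Kummer map `E(K) → H¹(K, E[n])` and `exists_kummerMap`

Trunk T-ELLARITH; discharge material for the named fact `WeierstrassCurve.exists_kummerMap` of
`Literature.NumberTheory.EllipticCurves.Selmer` (Silverman, *AEC*, VIII.§2, the Kummer sequence,
and X.4.2(a), the injectivity half of `0 → E(K)/nE(K) → Sel^(n)(E/K) → Ш(E/K)[n] → 0`).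
Everything here is proved. The Kummer map is constructed, and `exists_kummerMap W` derived, from
the `n`-divisibility of `E(K̄)` (`exists_kummerMap_of_zsmul_surjective`); the divisibility itself —
the exactness of `0 → E[m] → E(K̄) → E(K̄) → 0`, Silverman VIII.§2 with III.4.2(a), II.2.3, and
III.2.5 for singular `W` — enters through the named facts of `PointDivisibility`
(`exists_kummerMap_of_facts`), which are discharged in the sibling files `PointDivisibilityProofs`
(`zsmul_geomPoints_surjective_holds`) and `SingularCubic`
(`nonempty_geomPoints_addEquiv_units_of_node_holds`, `nonempty_geomPoints_addEquiv_of_cusp_holds`);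
the fact-free `exists_kummerMap_holds` is assembled from these in `SelmerProofs`.

## Contents (all proved)

* The **Kummer cocycle** of a point `Q ∈ E(K̄)` with `nQ ∈ E(K̄)^{Γ_K}` (`n : ℤ`):
  `kummerCocycleTorsion W n Q _ : σ ↦ σQ - Q`, a continuous crossed homomorphism `Γ_K → E[n]`
  (the coboundary `Literature.cobCocycle Q` of `E(K̄)`, a discrete `Γ_K`-module by
  `continuous_smul_geomPoints`, with values restricted to `E[n]` by `Literature.NumberTheory.GaloisRepresentations.contOneCocycles.lift` —
  the device of file `SelmerCorankProofs` for `E[p^∞]`), and its class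
  `kummerClassTorsion W n Q _ ∈ H¹(K, E[n]) = galH1Torsion W n` in Mathlib's continuous cohomology
  (interface `Literature.NumberTheory.GaloisRepresentations.oneCocycleClass` of `ContinuousH1`).
* `kummerClassTorsion` is additive in `Q`, depends only on `nQ`, vanishes iff `Q ∈ E(K̄)^Γ + E[n]`
  (`kummerClassTorsion_eq_zero_iff`), dies in `H¹(K, E)` (`torsionH1ToH1_kummerClassTorsion`) and
  in every `H¹(E, E(K̄_E))` (`kummerClassTorsion_mem_selmerLocalKerOfEmb`: the local conditions).
* Granted an `n`-th root in `E(K̄)` of every rational point (`hdiv`), the **Kummer map**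
  `kummerMapTorsion W n hdiv : E(K) →+ H¹(K, E[n])`, `P ↦ [σ ↦ σQ - Q]` (`nQ = P`), with
  `ker = nE(K)` (`kummerMapTorsion_ker`, by Galois descent `E(K̄)^Γ = E(K)`,
  `exists_toGeomPoints_eq_of_forall_smul_eq`) and
  `range = Sel^(n)(E/K) ⊓ ker (H¹(K, E[n]) → H¹(K, E))` (`torsionH1ToH1_kummerMapTorsion`,
  `kummerMapTorsion_mem_selmerLocalKer`, `mem_range_kummerMapTorsion_of_torsionH1ToH1_eq_zero`).
* Assembly over a number field: `exists_kummerMap_of_zsmul_surjective` (the statement of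
  `exists_kummerMap` at a fixed `n`, from the surjectivity of `[n]` on `E(K̄)`);
  `exists_kummerMap_of_isElliptic` (`exists_kummerMap W` for an elliptic curve from the named fact
  `zsmul_geomPoints_surjective`, Silverman VIII.§2 / III.4.2(a) / II.2.3);
  `exists_kummerMap_of_facts` (`exists_kummerMap W` for an arbitrary Weierstrass curve over a
  number field, the singular case from Prop. III.2.5).

## Why the singular case

`exists_kummerMap` is stated in `Selmer.lean` for every Weierstrass curve `W` over a number field,
without the standing hypothesis "`E` is an elliptic curve" of Silverman's Chapters VIII and X. It
is nevertheless true as stated (Mathlib's `W.toAffine.Point` is the group `E_ns ∪ {O}` of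
nonsingular points, Silverman III.2.5), and the cohomological argument below is uniform in `W`;
what depends on `W` is only the divisibility of `E(K̄)`:
* elliptic `W`: `WeierstrassCurve.zsmul_geomPoints_surjective` (§VIII.2: `0 → E[m] → E(K̄) →
  E(K̄) → 0` is exact; III.4.2(a) + II.2.3);
* singular `W`: Prop. III.2.5 (`nonempty_geomPoints_addEquiv_units_of_node`,
  `nonempty_geomPoints_addEquiv_of_cusp`), giving divisibility in characteristic `0`
  (`zsmul_geomPoints_surjective_of_singular`, proved in `PointDivisibility`).

## The argument (Silverman, AEC, VIII.§2 and X.§4, restated)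

For `P ∈ E(K)` choose `Q ∈ E(K̄)` with `nQ = P` and put `κ(P) = [σ ↦ σQ - Q] ∈ H¹(K, E[n])`
(`σQ - Q ∈ E[n]` since `n(σQ - Q) = σP - P = 0`; another root changes the cocycle by a
coboundary). `κ(P) = 0` iff `σQ - Q = σT - T` for some `T ∈ E[n]`, iff `Q - T ∈ E(K̄)^Γ = E(K)`
(Galois descent over the perfect field `K`), iff `P = n(Q - T) ∈ nE(K)`. The image of `κ(P)` in
`H¹(K, E)` is the class of the coboundary of `Q`, hence `0`; the same holds in each
`H¹(K_v, E(K̄_v))` with the coboundary of `ι(Q)`, so `κ(P) ∈ Sel^(n)`. Conversely if a continuous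
cocycle `f : Γ_K → E[n]` becomes a coboundary in `E(K̄)`, `f(σ) = σQ - Q`, then `n(σQ - Q) = 0`
shows `nQ ∈ E(K̄)^Γ = E(K)` and `[f] = κ(nQ)`.

## References

* [SilvermanAEC2009] J. H. Silverman, *The Arithmetic of Elliptic Curves*, 2nd ed., GTM 106,
  Springer 2009: §VIII.2 (the Kummer sequence for `E/K`, connecting homomorphism
  `δ(P)(σ) = Q^σ - Q`, book p. 190–191), Thm. X.4.2(a) and the definition of `S^{(φ)}(E/K)`
  preceding it (book p. 285–286), Prop. III.2.5, Prop. III.4.2(a), Thm. II.2.3.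
* J.-P. Serre, *Galois Cohomology*, I.§2.2–2.4, I.§5.1, II.§1.1 (continuous cochains, compatible
  pairs, `H¹` as crossed homomorphisms, discrete Galois modules).

## Design

* Group-wide rules of `Selmer`/`GaloisAction`: `noncomputable section`, `open scoped Classical`,
  one universe `u` with `K E : Type u`; deliberate dot-notation extensions in
  `namespace WeierstrassCurve`.
* Reuse, not restatement: `E(K) → E(K̄)` and Galois descent are `toGeomPoints`,
  `smul_toGeomPoints`, `exists_toGeomPoints_eq_of_forall_smul_eq` of `SelmerCorankProofs` (which
  builds the analogous `p^∞` Kummer map `kummerMapPInfty`; the finite-level objects here carry the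
  suffix `Torsion`, as `galH1Torsion` vs `galH1Primary`), and the cocycle criterion for the local
  kernels is `Literature.NumberTheory.EllipticCurves.oneCocycleClass_mem_resKer_iff` of `H1UnramifiedFinite`.
* The Kummer map is first built for a fixed `n : ℤ` from the hypothesis
  `hdiv : ∀ P, ∃ Q, n • Q = P` on `E(K̄)`; the named facts enter only in the assembly theorems.
-/

noncomputable section

open scoped Classical
open scoped AddSubgroup

universe u

namespace WeierstrassCurve

open Literature.NumberTheory.GaloisRepresentations Literature.NumberTheory.EllipticCurves

variable {K : Type u} [Field K] (W : WeierstrassCurve K)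

/-! ## Rational points inside `E(K̄)` -/

/-- The image of `E(K)` consists of `Γ_K`-fixed points. Silverman, *AEC*, VIII.§1. [folklore] -/
theorem toGeomPoints_mem_fixedPoints (P : W.toAffine.Point) :
    toGeomPoints W P ∈ MulAction.fixedPoints (Field.absoluteGaloisGroup K) (geomPoints W) :=
  fun σ => smul_toGeomPoints W σ P

/-- Galois descent for `toGeomPoints`: over a perfect field the `Γ_K`-fixed geometric points are
exactly the image of `E(K)` (`fixedPoints_eq_range_map_holds`). Silverman, *AEC*, VIII.§1.
[folklore] -/
theorem mem_range_toGeomPoints_iff [PerfectField K] (Q : geomPoints W) :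
    Q ∈ Set.range (toGeomPoints W) ↔
      Q ∈ MulAction.fixedPoints (Field.absoluteGaloisGroup K) (geomPoints W) :=
  ⟨by rintro ⟨P, rfl⟩; exact toGeomPoints_mem_fixedPoints W P,
    fun h => exists_toGeomPoints_eq_of_forall_smul_eq W h⟩

/-! ## The Kummer cocycle of a division point -/

section Kummer

variable (n : ℤ)

/-- Membership in the geometric `n`-torsion: `P ∈ E[n] ↔ n • P = 0`. [folklore] -/
theorem mem_geomTorsion_iff (P : geomPoints W) : P ∈ geomTorsion W n ↔ n • P = 0 :=
  Submodule.mem_torsionBy_iff n P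

/-- `σ • (n • Q) = n • (σ • Q)` for the Galois action on `E(K̄)`. [folklore] -/
theorem smul_zsmul_geomPoints (σ : Field.absoluteGaloisGroup K) (Q : geomPoints W) :
    σ • (n • Q) = n • (σ • Q) :=
  map_zsmul (DistribSMul.toAddMonoidHom (geomPoints W) σ) n Q

variable {W n} in
/-- For `Q ∈ E(K̄)` with `n • Q` fixed by `Γ_K`, the point `σ • Q - Q` is `n`-torsion.
Silverman, *AEC*, VIII.§2 (p. 191). [folklore] -/
theorem smul_sub_mem_geomTorsion {Q : geomPoints W}
    (hQ : n • Q ∈ MulAction.fixedPoints (Field.absoluteGaloisGroup K) (geomPoints W))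
    (σ : Field.absoluteGaloisGroup K) : σ • Q - Q ∈ geomTorsion W n := by
  rw [mem_geomTorsion_iff, zsmul_sub, ← smul_zsmul_geomPoints, hQ σ, sub_self]

/-- The **Kummer cocycle** `σ ↦ σ • Q - Q ∈ E[n]` of a point `Q ∈ E(K̄)` with `n • Q` fixed by
`Γ_K`, as a continuous crossed homomorphism `Γ_K → E[n]`: the coboundary of `Q` in the discrete
`Γ_K`-module `E(K̄)` (`Literature.NumberTheory.EllipticCurves.cobCocycle`), with values restricted to `E[n]`
(`Literature.NumberTheory.GaloisRepresentations.contOneCocycles.lift`). Silverman, *AEC*, VIII.§2 (p. 191: `c_σ = Q^σ - Q`). [folklore] -/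
def kummerCocycleTorsion (Q : geomPoints W)
    (hQ : n • Q ∈ MulAction.fixedPoints (Field.absoluteGaloisGroup K) (geomPoints W)) :
    contOneCocycles (discreteTopRep (Field.absoluteGaloisGroup K) (geomTorsion W n)) :=
  contOneCocycles.lift (geomTorsion W n).subtype (fun _ _ => rfl) Subtype.val_injective
    (cobCocycle Q (continuous_smul_geomPoints W Q))
    (fun σ => ⟨σ • Q - Q, smul_sub_mem_geomTorsion hQ σ⟩) (fun _ => rfl)

/-- Values of the Kummer cocycle. [folklore] -/
@[simp]
theorem coe_kummerCocycleTorsion_apply (Q : geomPoints W)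
    (hQ : n • Q ∈ MulAction.fixedPoints (Field.absoluteGaloisGroup K) (geomPoints W))
    (σ : Field.absoluteGaloisGroup K) :
    ((kummerCocycleTorsion W n Q hQ).1 σ : geomPoints W) = σ • Q - Q :=
  rfl

/-- The **Kummer class** `[σ ↦ σ • Q - Q] ∈ H¹(K, E[n])` of a point `Q ∈ E(K̄)` with
`n • Q ∈ E(K̄)^Γ`. Silverman, *AEC*, VIII.§2 (the connecting homomorphism `δ`, p. 191).
[folklore] -/
def kummerClassTorsion (Q : geomPoints W)
    (hQ : n • Q ∈ MulAction.fixedPoints (Field.absoluteGaloisGroup K) (geomPoints W)) :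
    galH1Torsion W n :=
  oneCocycleClass _ (kummerCocycleTorsion W n Q hQ)

/-- Additivity of the Kummer cocycle in `Q`. [folklore] -/
theorem kummerCocycleTorsion_add (Q Q' : geomPoints W)
    (hQ : n • Q ∈ MulAction.fixedPoints (Field.absoluteGaloisGroup K) (geomPoints W))
    (hQ' : n • Q' ∈ MulAction.fixedPoints (Field.absoluteGaloisGroup K) (geomPoints W))
    (hQQ' : n • (Q + Q') ∈ MulAction.fixedPoints (Field.absoluteGaloisGroup K) (geomPoints W)) :
    kummerCocycleTorsion W n (Q + Q') hQQ' =
      kummerCocycleTorsion W n Q hQ + kummerCocycleTorsion W n Q' hQ' := by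
  apply Subtype.ext
  ext σ : 1
  apply Subtype.ext
  change σ • (Q + Q') - (Q + Q') = (σ • Q - Q) + (σ • Q' - Q')
  rw [smul_add]
  abel

/-- Additivity of the Kummer class in `Q`. [folklore] -/
theorem kummerClassTorsion_add (Q Q' : geomPoints W)
    (hQ : n • Q ∈ MulAction.fixedPoints (Field.absoluteGaloisGroup K) (geomPoints W))
    (hQ' : n • Q' ∈ MulAction.fixedPoints (Field.absoluteGaloisGroup K) (geomPoints W))
    (hQQ' : n • (Q + Q') ∈ MulAction.fixedPoints (Field.absoluteGaloisGroup K) (geomPoints W)) :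
    kummerClassTorsion W n (Q + Q') hQQ' =
      kummerClassTorsion W n Q hQ + kummerClassTorsion W n Q' hQ' := by
  unfold kummerClassTorsion
  rw [kummerCocycleTorsion_add W n Q Q' hQ hQ', oneCocycleClass_add]

variable {W n} in
/-- Kummer classes of equal points are equal (proof-irrelevance helper). [folklore] -/
theorem kummerClassTorsion_congr {Q Q' : geomPoints W}
    {hQ : n • Q ∈ MulAction.fixedPoints (Field.absoluteGaloisGroup K) (geomPoints W)}
    {hQ' : n • Q' ∈ MulAction.fixedPoints (Field.absoluteGaloisGroup K) (geomPoints W)}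
    (h : Q = Q') : kummerClassTorsion W n Q hQ = kummerClassTorsion W n Q' hQ' := by
  subst h; rfl

/-- The Kummer class vanishes iff `Q` is a `Γ_K`-fixed point up to `n`-torsion.
Silverman, *AEC*, VIII.§2 (exactness of the Kummer sequence at `E(K)/mE(K)`). [folklore] -/
theorem kummerClassTorsion_eq_zero_iff (Q : geomPoints W)
    (hQ : n • Q ∈ MulAction.fixedPoints (Field.absoluteGaloisGroup K) (geomPoints W)) :
    kummerClassTorsion W n Q hQ = 0 ↔ ∃ T ∈ geomTorsion W n,
      Q - T ∈ MulAction.fixedPoints (Field.absoluteGaloisGroup K) (geomPoints W) := by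
  unfold kummerClassTorsion
  rw [oneCocycleClass_eq_zero_iff]
  constructor
  · rintro ⟨v, hv⟩
    refine ⟨v.1, v.2, fun σ => ?_⟩
    have h := congrArg Subtype.val (hv σ)
    change σ • Q - Q = σ • (v : geomPoints W) - v at h
    rw [smul_sub, sub_eq_sub_iff_sub_eq_sub, h]
  · rintro ⟨T, hT, hfix⟩
    refine ⟨⟨T, hT⟩, fun σ => Subtype.ext ?_⟩
    change σ • Q - Q = σ • T - T
    have h := hfix σ
    rw [smul_sub, sub_eq_sub_iff_sub_eq_sub] at h
    exact h

/-- The Kummer class of an `n`-torsion point is zero. [folklore] -/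
theorem kummerClassTorsion_eq_zero_of_mem (T : geomPoints W) (hT : T ∈ geomTorsion W n)
    (hT' : n • T ∈ MulAction.fixedPoints (Field.absoluteGaloisGroup K) (geomPoints W)) :
    kummerClassTorsion W n T hT' = 0 :=
  (kummerClassTorsion_eq_zero_iff W n T hT').mpr
    ⟨T, hT, by rw [sub_self]; exact fun σ => smul_zero σ⟩

/-- The Kummer class of `Q` depends only on `n • Q`. Silverman, *AEC*, VIII.§2 (`δ` is well
defined). [folklore] -/
theorem kummerClassTorsion_eq_of_zsmul_eq (Q Q' : geomPoints W)
    (hQ : n • Q ∈ MulAction.fixedPoints (Field.absoluteGaloisGroup K) (geomPoints W))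
    (hQ' : n • Q' ∈ MulAction.fixedPoints (Field.absoluteGaloisGroup K) (geomPoints W))
    (h : n • Q = n • Q') :
    kummerClassTorsion W n Q hQ = kummerClassTorsion W n Q' hQ' := by
  have hT : Q' - Q ∈ geomTorsion W n := by
    rw [mem_geomTorsion_iff, zsmul_sub, h, sub_self]
  have hT' : n • (Q' - Q) ∈ MulAction.fixedPoints (Field.absoluteGaloisGroup K) (geomPoints W) := by
    rw [(mem_geomTorsion_iff W n _).mp hT]
    exact fun σ => smul_zero σ
  have hsum : n • (Q + (Q' - Q)) ∈
      MulAction.fixedPoints (Field.absoluteGaloisGroup K) (geomPoints W) := by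
    rw [add_sub_cancel]; exact hQ'
  rw [kummerClassTorsion_congr (hQ := hQ') (hQ' := hsum) (add_sub_cancel Q Q').symm,
    kummerClassTorsion_add W n Q (Q' - Q) hQ hT' hsum,
    kummerClassTorsion_eq_zero_of_mem W n _ hT hT', add_zero]

/-- The Kummer class dies in `H¹(K, E)`: its image under `H¹(K, E[n]) → H¹(K, E)` is the class of
the coboundary `σ ↦ σ • Q - Q`. Silverman, *AEC*, VIII.§2 (exactness of the Kummer sequence at
`H¹(G, E[m])`). [folklore] -/
theorem torsionH1ToH1_kummerClassTorsion (Q : geomPoints W)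
    (hQ : n • Q ∈ MulAction.fixedPoints (Field.absoluteGaloisGroup K) (geomPoints W)) :
    torsionH1ToH1 W n (kummerClassTorsion W n Q hQ) = 0 := by
  unfold torsionH1ToH1 kummerClassTorsion
  simp only [LinearMap.toAddMonoidHom_coe, ContinuousLinearMap.coe_coe]
  rw [map_oneCocycleClass, oneCocycleClass_eq_zero_iff]
  exact ⟨Q, fun σ => rfl⟩

variable {E : Type u} [Field E] [Algebra K E]

/-- The Kummer class dies in every `H¹(E, E(K̄_E))` (`E` a `K`-field, `ι : K̄ → K̄_E`): its image is
the class of the coboundary of `ι(Q)`. Hence Kummer classes satisfy the local Selmer conditions.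
Silverman, *AEC*, X.§4 (diagram (**), p. 285). [folklore] -/
theorem kummerClassTorsion_mem_selmerLocalKerOfEmb (ι : AlgebraicClosure K →ₐ[K] AlgebraicClosure E)
    (Q : geomPoints W)
    (hQ : n • Q ∈ MulAction.fixedPoints (Field.absoluteGaloisGroup K) (geomPoints W)) :
    kummerClassTorsion W n Q hQ ∈ selmerLocalKerOfEmb W E ι n := by
  unfold kummerClassTorsion selmerLocalKerOfEmb
  rw [oneCocycleClass_mem_resKer_iff]
  refine ⟨pointsMapOfEmb W ι Q, fun x => ?_⟩
  change pointsMapOfEmb W ι (resGalOfEmb ι x • Q - Q) = _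
  rw [map_sub, pointsMapOfEmb_smul]

end Kummer

/-! ## The Kummer map on `E(K)` -/

section KummerMap

variable (n : ℤ) (hdiv : ∀ P : geomPoints W, ∃ Q : geomPoints W, n • Q = P)

/-- A chosen `n`-th root ("`n`-division point") in `E(K̄)` of the image of a rational point
`P ∈ E(K)`, granted the `n`-divisibility of `E(K̄)`. Silverman, *AEC*, VIII.§1–2 ("choose
`Q ∈ E(K̄)` with `[m]Q = P`"). [folklore] -/
def zsmulRoot (P : W.toAffine.Point) : geomPoints W :=
  Classical.choose (hdiv (toGeomPoints W P))

/-- `n • zsmulRoot P = P`. [folklore] -/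
theorem zsmul_zsmulRoot (P : W.toAffine.Point) :
    n • zsmulRoot W n hdiv P = toGeomPoints W P :=
  Classical.choose_spec (hdiv (toGeomPoints W P))

/-- `n • zsmulRoot P` is `Γ_K`-fixed. [folklore] -/
theorem zsmul_zsmulRoot_mem (P : W.toAffine.Point) :
    n • zsmulRoot W n hdiv P ∈
      MulAction.fixedPoints (Field.absoluteGaloisGroup K) (geomPoints W) := by
  rw [zsmul_zsmulRoot]
  exact toGeomPoints_mem_fixedPoints W P

/-- The Kummer map `E(K) → H¹(K, E[n])`, `P ↦ [σ ↦ σ • Q - Q]` with `n • Q = P`, as a bare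
function. Silverman, *AEC*, VIII.§2 (p. 191). [folklore] -/
def kummerMapTorsionFun (P : W.toAffine.Point) : galH1Torsion W n :=
  kummerClassTorsion W n (zsmulRoot W n hdiv P) (zsmul_zsmulRoot_mem W n hdiv P)

/-- The Kummer map does not depend on the chosen root: any `Q` with `n • Q = P` computes it.
Silverman, *AEC*, VIII.§2. [folklore] -/
theorem kummerMapTorsionFun_eq (P : W.toAffine.Point) (Q : geomPoints W)
    (hQ : n • Q = toGeomPoints W P) :
    kummerMapTorsionFun W n hdiv P = kummerClassTorsion W n Q
      (by rw [hQ]; exact toGeomPoints_mem_fixedPoints W P) :=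
  kummerClassTorsion_eq_of_zsmul_eq W n _ _ _ _ (by rw [zsmul_zsmulRoot, hQ])

/-- **The Kummer map** `κ : E(K) →+ H¹(K, E[n])`, `P ↦ [σ ↦ σ • Q - Q]` (`n • Q = P`), the
connecting homomorphism of the Kummer sequence `0 → E[n] → E(K̄) → E(K̄) → 0` in continuous
Galois cohomology; requires the `n`-divisibility of `E(K̄)` (`hdiv`).
Silverman, *AEC*, VIII.§2 (p. 190–191). [folklore] -/
def kummerMapTorsion : W.toAffine.Point →+ galH1Torsion W n :=
  AddMonoidHom.mk' (kummerMapTorsionFun W n hdiv) fun P P' => by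
    have h : n • (zsmulRoot W n hdiv P + zsmulRoot W n hdiv P') = toGeomPoints W (P + P') := by
      rw [zsmul_add, zsmul_zsmulRoot, zsmul_zsmulRoot, map_add]
    rw [kummerMapTorsionFun_eq W n hdiv (P + P') _ h]
    exact kummerClassTorsion_add W n _ _ _ _ _

/-- Unfolding `kummerMapTorsion`. [folklore] -/
theorem kummerMapTorsion_apply (P : W.toAffine.Point) :
    kummerMapTorsion W n hdiv P = kummerMapTorsionFun W n hdiv P :=
  rfl

/-- **Kernel of the Kummer map**: `κ P = 0 ↔ P ∈ nE(K)` (over a perfect field, using Galois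
descent `E(K̄)^Γ = E(K)`). Silverman, *AEC*, VIII.§2 (exactness of the Kummer sequence at
`E(K)/mE(K)`; also VIII.1.2). [folklore] -/
theorem kummerMapTorsion_ker [PerfectField K] :
    (kummerMapTorsion W n hdiv).ker = (zsmulAddGroupHom (α := W.toAffine.Point) n).range := by
  ext P
  rw [AddMonoidHom.mem_ker, AddMonoidHom.mem_range, kummerMapTorsion_apply, kummerMapTorsionFun,
    kummerClassTorsion_eq_zero_iff]
  constructor
  · rintro ⟨T, hT, hfixT⟩
    obtain ⟨R, hR⟩ := (mem_range_toGeomPoints_iff W _).mpr hfixT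
    refine ⟨R, toGeomPoints_injective W ?_⟩
    change toGeomPoints W (n • R) = toGeomPoints W P
    rw [map_zsmul, hR, zsmul_sub, zsmul_zsmulRoot, (mem_geomTorsion_iff W n T).mp hT, sub_zero]
  · rintro ⟨R, rfl⟩
    refine ⟨zsmulRoot W n hdiv (zsmulAddGroupHom n R) - toGeomPoints W R, ?_, ?_⟩
    · rw [mem_geomTorsion_iff, zsmul_sub, zsmul_zsmulRoot, ← map_zsmul, sub_eq_zero]
      rfl
    · rw [sub_sub_cancel]
      exact toGeomPoints_mem_fixedPoints W R

/-- The Kummer map lands in the kernel of `H¹(K, E[n]) → H¹(K, E)`. Silverman, *AEC*, VIII.§2.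
[folklore] -/
theorem torsionH1ToH1_kummerMapTorsion (P : W.toAffine.Point) :
    torsionH1ToH1 W n (kummerMapTorsion W n hdiv P) = 0 :=
  torsionH1ToH1_kummerClassTorsion W n _ _

/-- The Kummer map satisfies every local condition: `κ P ∈ selmerLocalKer W E n` for every
`K`-field `E`. Silverman, *AEC*, X.§4 (diagram (**)). [folklore] -/
theorem kummerMapTorsion_mem_selmerLocalKer (E : Type u) [Field E] [Algebra K E]
    (P : W.toAffine.Point) : kummerMapTorsion W n hdiv P ∈ selmerLocalKer W E n :=
  kummerClassTorsion_mem_selmerLocalKerOfEmb W n (closureEmb (K := K) E) _ _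

/-- **Exactness at `H¹(K, E[n])`**: a class killed by `H¹(K, E[n]) → H¹(K, E)` is a Kummer class
(over a perfect field). If `[f] ↦ 0` then `f σ = σ • Q - Q` for some `Q ∈ E(K̄)`, and `n • Q` is
`Γ_K`-fixed, hence rational. Silverman, *AEC*, VIII.§2 (exactness of the Kummer sequence at
`H¹(G, E[m])`). [folklore] -/
theorem mem_range_kummerMapTorsion_of_torsionH1ToH1_eq_zero [PerfectField K]
    (ξ : galH1Torsion W n) (hξ : torsionH1ToH1 W n ξ = 0) :
    ξ ∈ (kummerMapTorsion W n hdiv).range := by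
  obtain ⟨f, rfl⟩ := oneCocycleClass_surjective _ ξ
  unfold torsionH1ToH1 at hξ
  simp only [LinearMap.toAddMonoidHom_coe, ContinuousLinearMap.coe_coe] at hξ
  rw [map_oneCocycleClass, oneCocycleClass_eq_zero_iff] at hξ
  obtain ⟨Q, hQ⟩ := hξ
  have hf : ∀ σ, ((f.1 σ : geomTorsion W n) : geomPoints W) = σ • Q - Q := hQ
  have hnQ : n • Q ∈ MulAction.fixedPoints (Field.absoluteGaloisGroup K) (geomPoints W) := by
    intro σ
    rw [smul_zsmul_geomPoints, ← sub_eq_zero, ← zsmul_sub, ← hf σ]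
    exact (mem_geomTorsion_iff W n _).mp (f.1 σ).2
  obtain ⟨P, hP⟩ := (mem_range_toGeomPoints_iff W _).mpr hnQ
  refine ⟨P, ?_⟩
  rw [kummerMapTorsion_apply, kummerMapTorsionFun_eq W n hdiv P Q hP.symm]
  unfold kummerClassTorsion
  congr 1
  apply Subtype.ext
  ext σ : 1
  exact Subtype.ext (hf σ).symm

end KummerMap

/-! ## Assembly over a number field -/

section NumberField

variable [NumberField K]

/-- **The Kummer sequence / X.4.2(a), injectivity half, at a fixed `n`, from the surjectivity of
`[n]` on `E(K̄)`.** For a Weierstrass curve `W` over a number field `K` and `n : ℤ` such that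
multiplication by `n` is surjective on `E(K̄)`, the Kummer map `κ : E(K) → H¹(K, E[n])` has kernel
`nE(K)` and image `Sel^(n)(E/K) ∩ ker (H¹(K, E[n]) → H¹(K, E))`.
Silverman, *AEC*, §VIII.2 (Kummer sequence) and Thm. X.4.2(a). [cite: SilvermanAEC2009, §VIII.2 and Thm X.4.2(a)] -/
theorem exists_kummerMap_of_zsmul_surjective {n : ℤ}
    (hdiv : Function.Surjective fun Q : geomPoints W => n • Q) :
    ∃ κ : W.toAffine.Point →+ galH1Torsion W n,
      κ.ker = (zsmulAddGroupHom (α := W.toAffine.Point) n).range ∧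
        κ.range = selmerGroup W n ⊓ (torsionH1ToH1 W n).ker := by
  refine ⟨kummerMapTorsion W n hdiv, kummerMapTorsion_ker W n hdiv, le_antisymm ?_ ?_⟩
  · rintro _ ⟨P, rfl⟩
    refine ⟨(mem_selmerGroup_iff W n _).mpr ⟨fun v => ?_, fun w => ?_⟩, ?_⟩
    · exact kummerMapTorsion_mem_selmerLocalKer W n hdiv _ P
    · exact kummerMapTorsion_mem_selmerLocalKer W n hdiv _ P
    · exact torsionH1ToH1_kummerMapTorsion W n hdiv P
  · rintro ξ ⟨-, hξ⟩
    exact mem_range_kummerMapTorsion_of_torsionH1ToH1_eq_zero W n hdiv ξ hξ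

/-- **`exists_kummerMap` for an elliptic curve** (the setting of the source), from the named fact
`zsmul_geomPoints_surjective` (`[n] : E(K̄) → E(K̄)` is onto for `n ≠ 0`; Silverman §VIII.2,
Prop. III.4.2(a), Thm. II.2.3). Silverman, *AEC*, §VIII.2 and Thm. X.4.2(a).
[cite: SilvermanAEC2009, §VIII.2 and Thm X.4.2(a)] -/
theorem exists_kummerMap_of_isElliptic [W.IsElliptic] (h : W.zsmul_geomPoints_surjective) :
    W.exists_kummerMap := by
  intro n hn
  exact exists_kummerMap_of_zsmul_surjective W (h hn)

/-- **`exists_kummerMap` for an arbitrary Weierstrass curve over a number field**, from the named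
facts `zsmul_geomPoints_surjective` (elliptic case: Silverman §VIII.2 / III.4.2(a) / II.2.3) and
Prop. III.2.5 (singular case: `E_ns(K̄) ≅ K̄ˣ` or `K̄⁺`, both divisible in characteristic `0`).
This is the form in which `exists_kummerMap` is stated in `Selmer.lean` (no `IsElliptic`
hypothesis). Silverman, *AEC*, §VIII.2, Thm. X.4.2(a), Prop. III.2.5.
[cite: SilvermanAEC2009, §VIII.2 and Thm X.4.2(a)] -/
theorem exists_kummerMap_of_facts (h : W.zsmul_geomPoints_surjective)
    (ha : W.nonempty_geomPoints_addEquiv_units_of_node)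
    (hb : W.nonempty_geomPoints_addEquiv_of_cusp) : W.exists_kummerMap := by
  intro n hn
  exact exists_kummerMap_of_zsmul_surjective W (zsmul_geomPoints_surjective_of_facts W h ha hb hn)

end NumberField

end WeierstrassCurve
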